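import Summits.Ventures.HSemireg.WedgeHankelRecurrenceCompanionRepresentation
import Summits.Ventures.HSemireg.WedgeHankelRecurrenceResultant
import Summits.Ventures.HSemireg.WedgeHankelRecurrenceCompanion
import Literature.LinearAlgebra.AevalEigenvalueMultiplicities
import Mathlib.FieldTheory.IsAlgClosed.AlgebraicClosure

/-!
# Venture HSemireg — THE TSCHIRNHAUS TRANSFORM: THE CHARACTERISTIC POLYNOMIAL OF MULTIPLICATION BY `a` IN `K[X]/(m)`. For `m` monic of degree `t + 1`, any `a ∈ K[X]` and `M_a = mulResidueMat m a`:
# **`χ(M_a)` is the monic polynomial of degree `t + 1` whose roots, in any field over which `m` splits, are the values `a(λ)` at the roots `λ` of `m` (with multiplicity)** — the Tschirnhaus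
# transform of `m` by `a` — and **`χ(M_a)(a) ≡ 0 (mod m)`** (Cayley–Hamilton for the regular representation); on the way `M_p = 0 ⟺ m ∣ p` and `p(M_X) = 0 ⟺ m ∣ p` (the shift matrix has
# MINIMAL POLYNOMIAL `m`), `φ(det M_a) = ∏ a(λ)`.

HONEST FRAMING. Part of the Lean index of the computation cell `pub-hsemireg` (seat p10 gen 32, Sunday typer «UNIFORM-IN-n»).
LINEAR ALGEBRA OF HANKEL (catalecticant) MATRICES and of polynomials over a field ONLY (`Matrix.charpoly`, `Polynomial.aeval`, `Polynomial.comp`, the lineage's `mulResidueMat`): no variety, no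
cohomology theory, no sheaf, no Ext group and no semiregularity map is constructed here; «Tschirnhaus transform» is dictionary (no definition is introduced: it is `(mulResidueMat K t m a).charpoly`);
nothing here says that HC / HC_CM / HC_AV holds; no Literature FACT is declared or used — one PROVED Literature theorem is imported (`Literature.LinearAlgebra.AevalEigenvalues.matrix_charpoly_aeval_eq_prod`,
Rossmann §1.2 Lemma 6: over an algebraically closed field `χ(p(M)) = ∏ (X − p(λ_j))` over the eigenvalues of `M` with multiplicity).  Custodian versions as in `WedgeHankelSiegelIdeal` (1/3).

WHAT IS IN THE TREE.  N73 (`WedgeHankelRecurrenceHankelDeterminant`): `mulResidueMat`, `mulResidueMat_apply`.  N92 (`WedgeHankelRecurrenceCompanionRepresentation`): `mulResidueMat_eq_aeval` (`M_a = a(M_X)`).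
N82 (`WedgeHankelRecurrenceCompanion`): `charpoly_mulResidueMat_X` (`χ(M_X) = m`).  N94 (`WedgeHankelRecurrenceResultant`): `mulResidueMat_map` (base change), `det_mulResidueMat_eq_resultant`.  N109
(`WedgeHankelRecurrenceTraceRoots`): `φ(trace M_a) = Σ (φa)(λ)` (the `X^{t}`-coefficient of this file's product formula; not re-derived).  Mathlib: `Matrix.aeval_self_charpoly` (Cayley–Hamilton),
`Matrix.charpoly_map`, `Polynomial.aeval_algHom_apply`, `comp_eq_aeval`, `modByMonic_eq_zero_iff_dvd`, `Splits.roots_map`, `IsAlgClosed.splits`, `Matrix.det_eq_prod_roots_charpoly`; Mathlib's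
`charpoly_leftMulMatrix` treats the GENERATOR of a power basis (`= minpoly`) only.  `rg -i tschirnhaus` in Summits ∕ Literature: resolution-of-singularities uses (Tschirnhausen coordinate changes)
only — no statement about `K[X]/(m)`.
THIS FILE (namespace `Summit.Ventures.HSemireg.Wedge.HankelOuter` continued; PLAIN on N92 + N94 + N82 (tree) + the PROVED Literature module; 0 definitions):
* §688 **`mulResidueMat_eq_zero_iff`** (`M_p = 0 ⟺ m ∣ p`), **`aeval_mulResidueMat_X_eq_zero_iff`** (`p(M_X) = 0 ⟺ m ∣ p`: the minimal polynomial of the shift matrix is `m`),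
  **`dvd_charpoly_mulResidueMat_comp`** (`m ∣ χ(M_a) ∘ a`), **`aeval_adjoinRoot_mk_charpoly_mulResidueMat`** (`χ(M_a)(ā) = 0` in `K[X]/(m)`), `charpoly_mulResidueMat_natDegree`.
* §689 **`map_charpoly_mulResidueMat_eq_prod_of_isAlgClosed`** (`φ χ(M_a) = ∏_{λ ∈ roots(φm)} (X − (φa)(λ))`, `L` algebraically closed), **`map_charpoly_mulResidueMat_eq_prod`** (the same for ANY `φ` under
  which `m` splits — through `L̄`), `splits_map_charpoly_mulResidueMat`, **`roots_map_charpoly_mulResidueMat`** (`roots(φ χ(M_a)) = roots(φm).map (φa)`), `map_det_mulResidueMat_eq_prod_roots`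
  (`φ(det M_a) = ∏ (φa)(λ)`).
Nothing Ext-side.  New names only.
-/

open Module Polynomial
open scoped Matrix Polynomial

namespace Summit.Ventures.HSemireg.Wedge.HankelOuter

open Summit.Ventures.HSemireg.Wedge Summit.Ventures.HSemireg.Wedge.Hankel

variable (K : Type*) [Field K]

/-! ## §688. `M_p = 0 ⟺ m ∣ p`, and Cayley–Hamilton for the regular representation -/

/-- **`M_p = 0 ⟺ m ∣ p`** (`m` monic of degree `t + 1`): the multiplication matrix of `p` on `K[X]/(m)` vanishes exactly when `p ≡ 0`. -/
theorem mulResidueMat_eq_zero_iff {t : ℕ} {m : K[X]} (hm : m.Monic) (hmd : m.natDegree = t + 1) (p : K[X]) : mulResidueMat K t m p = 0 ↔ m ∣ p := by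
  refine ⟨fun h => ?_, fun h => ?_⟩
  · -- the `0`-th column is the coefficient vector of `p mod m`, a polynomial of degree `≤ t`
    rw [← Polynomial.modByMonic_eq_zero_iff_dvd hm]
    refine Polynomial.ext fun k => ?_
    rw [Polynomial.coeff_zero]
    by_cases hk : k < t + 1
    · have h1 := congrFun (congrFun h ⟨k, hk⟩) ⟨0, by omega⟩
      rwa [mulResidueMat_apply, Matrix.zero_apply, pow_zero, one_mul] at h1
    · exact Polynomial.coeff_eq_zero_of_natDegree_lt ((Polynomial.natDegree_modByMonic_lt p hm (fun h1 => by rw [h1, Polynomial.natDegree_one] at hmd; omega)).trans_le (by omega))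
  · ext k j
    rw [mulResidueMat_apply, (Polynomial.modByMonic_eq_zero_iff_dvd hm).mpr (h.trans (dvd_mul_left p _)), Polynomial.coeff_zero, Matrix.zero_apply]

/-- **`p(M_X) = 0 ⟺ m ∣ p`: the MINIMAL POLYNOMIAL of the shift (companion) matrix `M_X` of `K[X]/(m)` is `m`** (`m` monic of degree `t + 1`; N92 `p(M_X) = M_p`). -/
theorem aeval_mulResidueMat_X_eq_zero_iff {t : ℕ} {m : K[X]} (hm : m.Monic) (hmd : m.natDegree = t + 1) (p : K[X]) :
    aeval (mulResidueMat K t m Polynomial.X) p = 0 ↔ m ∣ p := by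
  rw [← mulResidueMat_eq_aeval K hm hmd, mulResidueMat_eq_zero_iff K hm hmd]

/-- **`m ∣ χ(M_a) ∘ a`** (`m` monic of degree `t + 1`): Cayley–Hamilton `χ(M_a)(M_a) = 0` with `M_a = a(M_X)` gives `(χ(M_a) ∘ a)(M_X) = 0`. -/
theorem dvd_charpoly_mulResidueMat_comp {t : ℕ} {m : K[X]} (hm : m.Monic) (hmd : m.natDegree = t + 1) (a : K[X]) :
    m ∣ ((mulResidueMat K t m a).charpoly).comp a := by
  rw [← aeval_mulResidueMat_X_eq_zero_iff K hm hmd, Polynomial.comp_eq_aeval, ← Polynomial.aeval_algHom_apply, ← mulResidueMat_eq_aeval K hm hmd a]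
  exact Matrix.aeval_self_charpoly _

/-- **CAYLEY–HAMILTON FOR THE REGULAR REPRESENTATION: `χ(M_a)(ā) = 0` in `K[X]/(m)`** — every element of `K[X]/(m)` is a root of the characteristic polynomial of its own multiplication matrix
(`m` monic of degree `t + 1`). -/
theorem aeval_adjoinRoot_mk_charpoly_mulResidueMat {t : ℕ} {m : K[X]} (hm : m.Monic) (hmd : m.natDegree = t + 1) (a : K[X]) :
    aeval (AdjoinRoot.mk m a) (mulResidueMat K t m a).charpoly = 0 := by
  rw [← AdjoinRoot.aeval_eq, Polynomial.aeval_algHom_apply, ← Polynomial.comp_eq_aeval, AdjoinRoot.aeval_eq, AdjoinRoot.mk_eq_zero]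
  exact dvd_charpoly_mulResidueMat_comp K hm hmd a

/-- `χ(M_a)` is monic of degree `t + 1` (Mathlib). -/
theorem charpoly_mulResidueMat_natDegree (t : ℕ) (m a : K[X]) : (mulResidueMat K t m a).charpoly.natDegree = t + 1 := by
  rw [Matrix.charpoly_natDegree_eq_dim, Fintype.card_fin]

/-! ## §689. The roots of `χ(M_a)` are the values `a(λ)` -/

/-- **`φ χ(M_a) = ∏_{λ ∈ roots(φ m)} (X − (φa)(λ))` for `φ : K → L` with `L` ALGEBRAICALLY CLOSED** (`m` monic of degree `t + 1`): base change `M_a ↦ M_{φa}` (N94), `M_{φa} = (φa)(M_X)` (N92),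
`χ(M_X) = φm` (N82), and the PROVED Literature spectral mapping with multiplicities (Rossmann §1.2 Lemma 6). -/
theorem map_charpoly_mulResidueMat_eq_prod_of_isAlgClosed {L : Type*} [Field L] [IsAlgClosed L] (φ : K →+* L) {t : ℕ} {m : K[X]} (hm : m.Monic) (hmd : m.natDegree = t + 1) (a : K[X]) :
    (mulResidueMat K t m a).charpoly.map φ = ((m.map φ).roots.map fun c => Polynomial.X - C ((a.map φ).eval c)).prod := by
  have hmd' : (m.map φ).natDegree = t + 1 := by rw [Polynomial.natDegree_map, hmd]
  rw [← Matrix.charpoly_map, mulResidueMat_map K φ t hm, mulResidueMat_eq_aeval L (hm.map φ) hmd', Literature.LinearAlgebra.AevalEigenvalues.matrix_charpoly_aeval_eq_prod,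
    charpoly_mulResidueMat_X L (hm.map φ) hmd']

/-- **THE TSCHIRNHAUS TRANSFORM: `φ χ(M_a) = ∏_{λ ∈ roots(φ m)} (X − (φa)(λ))` for ANY field embedding `φ : K → L` under which `m` splits** — through an algebraic closure of `L`, pulling the
identity back along the injective `L → L̄`. -/
theorem map_charpoly_mulResidueMat_eq_prod {L : Type*} [Field L] (φ : K →+* L) {t : ℕ} {m : K[X]} (hm : m.Monic) (hmd : m.natDegree = t + 1) (hs : (m.map φ).Splits) (a : K[X]) :
    (mulResidueMat K t m a).charpoly.map φ = ((m.map φ).roots.map fun c => Polynomial.X - C ((a.map φ).eval c)).prod := by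
  let ι := algebraMap L (AlgebraicClosure L)
  apply Polynomial.map_injective ι ι.injective
  have h := map_charpoly_mulResidueMat_eq_prod_of_isAlgClosed K (ι.comp φ) hm hmd a
  rw [← Polynomial.map_map, ← Polynomial.map_map, ← Polynomial.map_map, hs.roots_map ι, Multiset.map_map] at h
  rw [h, Polynomial.map_multiset_prod, Multiset.map_map]
  refine congrArg _ (Multiset.map_congr rfl fun c _ => ?_)
  simp only [Function.comp_apply, Polynomial.map_sub, Polynomial.map_X, Polynomial.map_C, Polynomial.eval_map, Polynomial.eval₂_hom]

/-- `φ χ(M_a)` splits wherever `φ m` does. -/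
theorem splits_map_charpoly_mulResidueMat {L : Type*} [Field L] (φ : K →+* L) {t : ℕ} {m : K[X]} (hm : m.Monic) (hmd : m.natDegree = t + 1) (hs : (m.map φ).Splits) (a : K[X]) :
    ((mulResidueMat K t m a).charpoly.map φ).Splits := by
  rw [map_charpoly_mulResidueMat_eq_prod K φ hm hmd hs a]
  exact Polynomial.Splits.multisetProd fun p hp => by
    obtain ⟨c, -, rfl⟩ := Multiset.mem_map.mp hp
    exact Polynomial.Splits.X_sub_C _

/-- **The roots of the Tschirnhaus transform, with multiplicity: `roots(φ χ(M_a)) = roots(φ m).map (φa)`** (`φ` any embedding under which `m` splits). -/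
theorem roots_map_charpoly_mulResidueMat {L : Type*} [Field L] [DecidableEq L] (φ : K →+* L) {t : ℕ} {m : K[X]} (hm : m.Monic) (hmd : m.natDegree = t + 1) (hs : (m.map φ).Splits) (a : K[X]) :
    ((mulResidueMat K t m a).charpoly.map φ).roots = (m.map φ).roots.map fun c => (a.map φ).eval c := by
  have h : (m.map φ).roots.map (fun c => Polynomial.X - C ((a.map φ).eval c)) = (((m.map φ).roots.map fun c => (a.map φ).eval c).map fun c => Polynomial.X - C c) := by
    rw [Multiset.map_map]; rfl
  rw [map_charpoly_mulResidueMat_eq_prod K φ hm hmd hs a, h, Polynomial.roots_multiset_prod_X_sub_C]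

/-- **`φ(det M_a) = ∏_{λ ∈ roots(φ m)} (φa)(λ)`** (`φ` any embedding under which `m` splits; with N94 this is `Res(m, a) = ∏ a(λ)`). -/
theorem map_det_mulResidueMat_eq_prod_roots {L : Type*} [Field L] [DecidableEq L] (φ : K →+* L) {t : ℕ} {m : K[X]} (hm : m.Monic) (hmd : m.natDegree = t + 1) (hs : (m.map φ).Splits) (a : K[X]) :
    φ (mulResidueMat K t m a).det = ((m.map φ).roots.map fun c => (a.map φ).eval c).prod := by
  rw [RingHom.map_det, RingHom.mapMatrix_apply, Matrix.det_eq_prod_roots_charpoly_of_splits (by rw [Matrix.charpoly_map]; exact splits_map_charpoly_mulResidueMat K φ hm hmd hs a), Matrix.charpoly_map,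
    roots_map_charpoly_mulResidueMat K φ hm hmd hs a]

end Summit.Ventures.HSemireg.Wedge.HankelOuter
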